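import Literature.Topology.FourManifolds.SmoothPoincareHighDimResidue
import HarnessLib

/-!
# spc4.S32 decomposed: the three stem computations `Θ₁₂ = Θ₅₆ = Θ₆₁ = 0` as named facts, and the assembly

Topic `Literature/Topology/FourManifolds`. Fact-decomposition record (librarian, fact-decompose,
2026-08-16) for the named fact `Literature.Topology.FourManifolds.nonemptyDiffeomorphSphere_of_mem`
(spc4.S32, `SPC4Wave0.lean`: the smooth Poincaré conjecture holds in dimensions
`n ∈ {1, 2, 3, 5, 6, 12, 56, 61}`), an XL fact that ran to the prover budget cap. Its proof files
(`SmoothPoincareHighDim.lean`, `SmoothPoincareHighDimResidue.lean`,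
`SmoothPoincareHighDimKervaireMilnor.lean`) prove that, GIVEN Milnor's h-cobordism theorem
(`isTrivial_of_isHCobordism_of_five_le`, *Lectures on the h-cobordism theorem*, Thm. 9.1), the
fact is EQUIVALENT to the conjunction of Perelman's theorem (`nonempty_diffeomorph_sphere_three`),
the Kervaire–Milnor–Wall theorem for `n = 5, 6` (`Milnor1965_boundsContractible_of_homologySphere`)
and the three statements "`Θ₁₂`, `Θ₅₆`, `Θ₆₁` are one point"
(`nonemptyDiffeomorphSphere_of_mem_iff_namedLeaves`). The first three leaves are named facts of the
tree; the three stem computations were so far only the opaque hypotheses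
`Subsingleton (HomotopySphereClass n)` of those theorems. They are printed theorems in their own
right and are named here, each with its source:

* `subsingleton_homotopySphereClass_twelve` — `Θ₁₂ = 0` (Kervaire–Milnor 1963, §1, table p. 504:
  `|Θ₁₂| = 1`; proof: `bP₁₃ = 0` (Thm. 5.1) and `Θ₁₂ / bP₁₃ ↪ Π₁₂ / im J = coker J₁₂ = 0`, Thm. 4.1
  with the Remarks p. 512 and Toda's tables; printed with proof in Kosinski, *Differential
  Manifolds*, Ch. X §6, p. 218: "`θ⁴ⁿ ≃ Coker J₄ₙ` … a comparison with Toda's tables yields …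
  `θ¹² = 0`");
* `subsingleton_homotopySphereClass_fiftySix` — `Θ₅₆ = 0` (Wang–Xu 2017, Thm. 1.14: "(Isaksen) The
  sphere `S⁵⁶` has a unique smooth structure"; `Θ₅₆^bp = 0` and `coker J₅₆ = 0` at odd primes
  (Ravenel) and at `2` (Isaksen 2019));
* `subsingleton_homotopySphereClass_sixtyOne` — `Θ₆₁ = 0` (Wang–Xu 2017, Thm. 1.9: "The 2-primary
  `π₆₁ = 0`, and therefore the sphere `S⁶¹` has a unique smooth structure").

In the tree `HomotopySphereClass n = Θₙ` is the type of oriented homotopy `n`-spheres (carriers in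
`Type`) modulo orientation-preserving diffeomorphism (`HomotopySpheres.lean`); for `n ≥ 5` this is
Kervaire–Milnor's h-cobordism group (Remark p. 505), and "`Sⁿ` has a unique smooth structure" is
exactly `Subsingleton (HomotopySphereClass n)` (`nonemptyDiffeomorphSphere_of_mem_iff_subsingleton`,
`SmoothPoincareHighDim.lean`). The assembly `nonemptyDiffeomorphSphere_of_mem_holds_of` is
`nonemptyDiffeomorphSphere_of_mem_of_namedLeaves` with the three stems named. The finer printed
road to `Θ₁₂ = 0` (Thm. 3.1, Lemma 4.2, `Π₁₂ = 0`, Thm. 5.1) is the theorem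
`subsingleton_homotopySphereClass_of_collapse_leaves` of `SmoothPoincareHighDimKervaireMilnor.lean`,
available to the prover of the first child.

## References

* [KervaireMilnorAnnals1963] M. Kervaire, J. Milnor, *Groups of homotopy spheres I*, Ann. of Math.
  77 (1963) 504–537: §1 table p. 504, Remark p. 505, Thm. 4.1 (p. 510), Remarks p. 512, Thm. 5.1.
* [Kosinski1993] A. Kosinski, *Differential Manifolds*, Academic Press 1993, Ch. X §6, (6.2),
  (6.6)–(6.7), p. 218.
* [WangXu2017] G. Wang, Z. Xu, *The triviality of the 61-stem in the stable homotopy groups of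
  spheres*, Ann. of Math. 186 (2017) 501–580, Thm. 1.7, Thm. 1.9, Thm. 1.14, Cor. 1.15.
* [Isaksen2019] D. Isaksen, *Stable stems*, Mem. AMS 262 (2019), Ch. 1.
* [MilnorHCobordism1965] J. Milnor, *Lectures on the h-cobordism theorem* (1965), Thm. 9.1, p. 111.
* [MorganTian2007] J. Morgan, G. Tian, *Ricci flow and the Poincaré conjecture* (2007), Cor. 0.2 (a).
-/

noncomputable section

open scoped Manifold ContDiff

namespace Literature.Topology.FourManifolds

universe u

/-! ### The three stems, named -/

/-- **`Θ₁₂ = 0`: the 12-sphere has a unique smooth structure** (up to orientation-preserving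
diffeomorphism, every oriented homotopy `12`-sphere is `S¹²`). Kervaire–Milnor 1963, §1, table
p. 504 (`|Θ₁₂| = 1`), obtained from `bP₁₃ = 0` (Thm. 5.1, `n = 12` even) and
`Θ₁₂ / bP₁₃ ≅ coker J₁₂ = 0` (Thm. 4.1, Remarks p. 512, Toda's tables); printed with proof in
Kosinski, *Differential Manifolds*, Ch. X §6, p. 218 ("`θ¹² = 0`"). In the tree's vocabulary:
`HomotopySphereClass 12` (oriented homotopy spheres modulo oriented diffeomorphism, which for
`n ≥ 5` is Kervaire–Milnor's `Θₙ`, Remark p. 505) has at most one element.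
[cite: KervaireMilnorAnnals1963, §1 table p. 504 (|Θ₁₂| = 1), Thm. 4.1, Remarks p. 512, Thm. 5.1]
[cite: Kosinski1993, Ch. X §6 p. 218 (θ¹² = 0), (6.2), (6.6)–(6.7)] -/
def subsingleton_homotopySphereClass_twelve : Prop :=
  Subsingleton (HomotopySphereClass 12)

/-- **`Θ₅₆ = 0`: the 56-sphere has a unique smooth structure** (Isaksen; Wang–Xu 2017, Thm. 1.14:
"(Isaksen) The sphere `S⁵⁶` has a unique smooth structure" — `Θ₅₆^bp = 0` by Kervaire–Milnor
(Thm. 1.7 (1) there), and the cokernel of `J` in dimension `56` vanishes at odd primes (Ravenel)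
and at the prime `2` (Isaksen 2019, Ch. 1)). In the tree's vocabulary: `HomotopySphereClass 56` has
at most one element. [cite: WangXu2017, Thm. 1.14 and Thm. 1.7] [cite: Isaksen2019, Ch. 1] -/
def subsingleton_homotopySphereClass_fiftySix : Prop :=
  Subsingleton (HomotopySphereClass 56)

/-- **`Θ₆₁ = 0`: the 61-sphere has a unique smooth structure** (Wang–Xu 2017, Thm. 1.9: "The
2-primary `π₆₁ = 0`, and therefore the sphere `S⁶¹` has a unique smooth structure"; proof p. 3:
`coker J₆₁` vanishes at odd primes (Ravenel) and at `2` (the 61-stem), and `Θ₆₁^bp = bP₆₂ = 0`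
since the Kervaire invariant element `θ₅ ∈ π₆₂` exists, Thm. 1.7 (2)). In the tree's vocabulary:
`HomotopySphereClass 61` has at most one element. [cite: WangXu2017, Thm. 1.9, Thm. 1.7 (2) and Cor. 1.15] -/
def subsingleton_homotopySphereClass_sixtyOne : Prop :=
  Subsingleton (HomotopySphereClass 61)

/-! ### The assembly -/

/-- **spc4.S32 from its six named leaves** (fact-decomposition glue, canonical name): the three
stem computations `Θ₁₂ = Θ₅₆ = Θ₆₁ = 0` (this file), Perelman's theorem
(`nonempty_diffeomorph_sphere_three`, spc4.S31), Milnor's h-cobordism theorem Thm. 9.1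
(`isTrivial_of_isHCobordism_of_five_le`) and the Kervaire–Milnor–Wall theorem `Θ₅ = Θ₆ = 0` in
bounding form (`Milnor1965_boundsContractible_of_homologySphere`) give the smooth Poincaré
conjecture in dimensions `1, 2, 3, 5, 6, 12, 56, 61` at every universe — this is
`nonemptyDiffeomorphSphere_of_mem_of_namedLeaves` (`SmoothPoincareHighDimResidue.lean`), which is an
EQUIVALENCE given Thm. 9.1 (`nonemptyDiffeomorphSphere_of_mem_iff_namedLeaves`).
[cite: KervaireMilnorAnnals1963, Thm. 1.2 and table p. 504] [cite: WangXu2017, Thm. 1.9, Thm. 1.14, Cor. 1.15]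
[cite: MilnorHCobordism1965, §9, Thm. 9.1 (p. 107) and p. 111] [cite: MorganTian2007, Cor. 0.2 (a)] -/
theorem nonemptyDiffeomorphSphere_of_mem_holds_of
    (h12 : subsingleton_homotopySphereClass_twelve)
    (h56 : subsingleton_homotopySphereClass_fiftySix)
    (h61 : subsingleton_homotopySphereClass_sixtyOne)
    (h3 : nonempty_diffeomorph_sphere_three.{0})
    (h91 : isTrivial_of_isHCobordism_of_five_le.{0})
    (hKM : Milnor1965_boundsContractible_of_homologySphere.{0}) :
    nonemptyDiffeomorphSphere_of_mem.{u} :=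
  nonemptyDiffeomorphSphere_of_mem_of_namedLeaves h3 h91 hKM h12 h56 h61

/-- Conversely the three stems are CONSEQUENCES of spc4.S32 (so the children are not stronger than
the parent): `namedLeaves_of_nonemptyDiffeomorphSphere_of_mem` of `SmoothPoincareHighDimResidue.lean`.
[cite: KervaireMilnorAnnals1963, Thm. 1.2 and table p. 504] [cite: WangXu2017, Cor. 1.15] -/
theorem subsingleton_homotopySphereClass_stems_of (h : nonemptyDiffeomorphSphere_of_mem.{u}) :
    subsingleton_homotopySphereClass_twelve ∧ subsingleton_homotopySphereClass_fiftySix ∧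
      subsingleton_homotopySphereClass_sixtyOne :=
  let H := namedLeaves_of_nonemptyDiffeomorphSphere_of_mem h
  ⟨H.2.2.1, H.2.2.2.1, H.2.2.2.2⟩

end Literature.Topology.FourManifolds

end
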